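import Literature.Barriers.ABC.BakerMethodBoundsKummerPlaceBoundsRegimeTwoProofs
import Literature.NumberTheory.Transcendental.Waldschmidt1980HW2
import Literature.NumberTheory.DiophantineGeometry.AbcWave0QualityFormProofs
import HarnessLib

/-!
# Cell abc-stewartyu, M3 (rung F-A1 = Stewart–Yu 2001, exponent 1/3): the Kummer door from `p`-adic bounds for
# rational PRIMES — support `KummerDoor` of the staged route `PadicPrimesKummerThird`

`Summits/ABC/StewartYu/KummerThirdPlaceBound.lean` — cell `abc-stewartyu` (seat p3; one predicate `Y07At` + theorems, no
named fact; companion of `Literature/Barriers/ABC/BakerMethodBoundsKummerPlaceBounds{,RegimeTwo}Proofs.lean`; sequel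
`KummerThirdDoor.lean` has the place bound at `p ∣ c` and the door itself).

Sequel to `BakerMethodBoundsKummerPlaceBounds{,RegimeTwo}Proofs.lean`: the two `p`-adic PLACE BOUNDS
(p ∣ a) `ν_p(a) log p < Θ_{bc} (p/log p)(log p + Y)` and (p ∣ c, ab > 1) `ν_p(c) log p < Θ_{ab} (p/log p)(log p + Y)`
(`Θ_{uv} = theta K u v 0 = K^{ω(uv)+1} ∏_{q ∣ uv} log q`, `Y = log max{e, 2 log c}`) follow from a `p`-adic estimate for
linear forms in the logarithms of DISTINCT PRIMES of Yu-2007 quality — constant `c₆^{#S}`, `p/(log p)²` in `ord_p`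
units, ONE logarithm `log p + log B + log log A` (`B ≥ 3` a bound for the exponents, `A = max(4, max S)`) — the texts
`Y07Odd` (odd `p`) and `Y07Two` (`p = 2`) of the rung route `PadicPrimesKummerThird` of cell abc-stewartyu, taken here
as displayed hypotheses.  Book-keeping: for `p ∣ a` take `S` = the primes of `bc`, `e_q = ν_q(b) − ν_q(c)`
(`∏ q^{e_q} = b/c`, `b/c − 1 = −a/c`), `B = max(3, 3 log c)`; for `p ∣ c` take `S` = the primes of `ab`,
`e_q = 2(ν_q(a) − ν_q(b))` (`∏ q^{e_q} = (a/b)²`, `ord_p((a/b)² − 1) ≥ ord_p(a/b + 1) = ν_p(c)`), `B = max(3, 6 log c)`;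
in both cases `log p + log B + log log A ≤ 4 (log p + Y)` and `4 c₆^{#S} ≤ K^{#S+1}` with `K = max(4, c₆)`.  With the
tree's archimedean input `waldschmidt1980_hW₂` this closes the barrier declaration:
`BakerMethodBounds_of_y07 : ⟨Y07Odd⟩ → ⟨Y07Two⟩ → BakerMethodBounds` (Stewart–Yu 2001's exponent `1/3`).
Everything is elementary book-keeping [cite: StewartYu2001, §3]; the texts themselves are NOT proved here.

## References

* [StewartYu2001] C. L. Stewart, K. Yu, *On the abc conjecture, II*, Duke Math. J. 108 (2001), 169–181 — §3.
* [Yu2007] K. Yu, *p-adic logarithmic forms and group varieties III*, Forum Math. 19 (2007) — Main Theorem (the quality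
  of the displayed hypotheses).
-/

noncomputable section

open Finset Real Height
open Literature.NumberTheory.DiophantineGeometry
open Literature.NumberTheory.DiophantineGeometry.Dioph
open Literature.NumberTheory.DiophantineGeometry.Pasten
open Literature.NumberTheory.Transcendental.Waldschmidt1980

namespace Summit.ABC.StewartYu.KummerThird

open Literature.Barriers.ABC

section PrimesDoor

variable {a b c : ℕ}

/-! ### Elementary facts about an abc triple -/

/-- The largest prime factor of `uv ≤ c²` is at most `c²`; hence `max(4, max S) ≤ 4c²` for `S` the primes of `uv`.
[folklore] -/
theorem cast_max_four_sup_le {u v c : ℕ} (huv : u * v ≤ c * c) (hc : 2 ≤ c) :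
    ((max 4 ((u * v).primeFactors.sup id) : ℕ) : ℝ) ≤ 4 * (c : ℝ) ^ 2 := by
  have hsup : (u * v).primeFactors.sup id ≤ u * v :=
    Finset.sup_le fun q hq => by simpa using Nat.le_of_mem_primeFactors hq
  have h1 : max 4 ((u * v).primeFactors.sup id) ≤ 4 * (c * c) := by
    have : 4 ≤ 4 * (c * c) := by nlinarith
    have : (u * v).primeFactors.sup id ≤ 4 * (c * c) := hsup.trans (huv.trans (by nlinarith))
    omega
  calc ((max 4 ((u * v).primeFactors.sup id) : ℕ) : ℝ) ≤ ((4 * (c * c) : ℕ) : ℝ) := by exact_mod_cast h1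
    _ = 4 * (c : ℝ) ^ 2 := by push_cast; ring

/-- `log log A ≤ log 2 + Y` for `A ≤ 4c²` (`A ≥ 4`), `Y = log max{e, 2 log c}`. [folklore] -/
theorem loglog_le_of_le_four_mul_sq {A : ℝ} (hA4 : 4 ≤ A) (hc : 2 ≤ c) (hA : A ≤ 4 * (c : ℝ) ^ 2) :
    Real.log (Real.log A) ≤ Real.log 2 + Real.log (max (Real.exp 1) (2 * Real.log c)) := by
  set M := max (Real.exp 1) (2 * Real.log c) with hM
  have hc0 : (0 : ℝ) < c := by exact_mod_cast (show 0 < c by omega)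
  have he : Real.exp 1 ≤ M := le_max_left _ _
  have hM0 : 0 < M := lt_of_lt_of_le (Real.exp_pos 1) he
  have he1 : (2.7 : ℝ) < Real.exp 1 := by have := Real.exp_one_gt_d9; linarith
  have hlog4 : Real.log 4 < 1.39 := by
    have h : Real.log 4 = 2 * Real.log 2 := by
      rw [show (4 : ℝ) = 2 ^ 2 by norm_num, Real.log_pow]; norm_num
    rw [h]; have := Real.log_two_lt_d9; linarith
  have hlogA : Real.log A ≤ 2 * M := by
    have h1 : Real.log A ≤ Real.log (4 * (c : ℝ) ^ 2) := Real.log_le_log (by linarith) hA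
    have h2 : Real.log (4 * (c : ℝ) ^ 2) = Real.log 4 + 2 * Real.log c := by
      rw [Real.log_mul (by norm_num) (by positivity), Real.log_pow]; push_cast; ring
    have h3 : 2 * Real.log c ≤ M := le_max_right _ _
    linarith
  have hlogA0 : 0 < Real.log A := Real.log_pos (by linarith)
  calc Real.log (Real.log A) ≤ Real.log (2 * M) := Real.log_le_log hlogA0 hlogA
    _ = Real.log 2 + Real.log M := Real.log_mul (by norm_num) hM0.ne'

/-- For an integer-valued exponent of an abc triple: `ν_q(u) ≤ (3/2) log c` when `u ≤ c`. [folklore] -/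
theorem factorization_le_log_c {u q : ℕ} (hu : u ≠ 0) (hq : q.Prime) (huc : u ≤ c) :
    (u.factorization q : ℝ) ≤ 3 / 2 * Real.log c := by
  have h1 := factorization_le_log hu hq
  have h2 : Real.log u ≤ Real.log c :=
    Real.log_le_log (by exact_mod_cast Nat.pos_of_ne_zero hu) (by exact_mod_cast huc)
  linarith

/-! ### The merged all-primes text -/

/-- The displayed `p`-adic bound for rational primes of Yu-2007 quality at the prime `p` with constant `C`
(the common shape of the two route texts). [cite: Yu2007, Main Theorem] -/
def Y07At (C : ℝ) (p : ℕ) : Prop :=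
  ∀ (S : Finset ℕ), (∀ q ∈ S, q.Prime) → p ∉ S → S.Nonempty → ∀ (e : ℕ → ℤ) (B : ℝ), 3 ≤ B →
    (∀ q ∈ S, (|e q| : ℝ) ≤ B) → ∏ q ∈ S, (q : ℚ) ^ e q ≠ 1 →
    (padicValRat p (∏ q ∈ S, (q : ℚ) ^ e q - 1) : ℝ) * Real.log p <
      C ^ S.card * ((p : ℝ) / Real.log p) *
        (Real.log p + Real.log B + Real.log (Real.log ((max 4 (S.sup id) : ℕ) : ℝ))) *
        ∏ q ∈ S, Real.log (q : ℝ)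

/-- The text is monotone in the constant for `0 ≤ |C| ≤ C'`. [folklore] -/
theorem y07At_mono {C C' : ℝ} (hCC' : |C| ≤ C') {p : ℕ} (hp : p.Prime) (h : Y07At C p) : Y07At C' p := by
  intro S hS hpS hne e B hB heB hne1
  have h0 := h S hS hpS hne e B hB heB hne1
  have hp1 : (1 : ℝ) < p := by exact_mod_cast hp.one_lt
  have hlp : 0 < Real.log p := Real.log_pos hp1
  have hB3 : 0 ≤ Real.log B := Real.log_nonneg (by linarith)
  have hA : 0 ≤ Real.log (Real.log ((max 4 (S.sup id) : ℕ) : ℝ)) := by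
    apply Real.log_nonneg
    have h4 : (4 : ℝ) ≤ ((max 4 (S.sup id) : ℕ) : ℝ) := by exact_mod_cast le_max_left _ _
    rw [← Real.log_exp 1] at *
    refine Real.log_le_log (Real.exp_pos 1) (le_trans ?_ h4)
    have := Real.exp_one_lt_d9; linarith
  have hL : 0 ≤ Real.log p + Real.log B + Real.log (Real.log ((max 4 (S.sup id) : ℕ) : ℝ)) := by linarith
  have hP : 0 ≤ ∏ q ∈ S, Real.log (q : ℝ) :=
    Finset.prod_nonneg fun q hq => Real.log_nonneg (by exact_mod_cast (hS q hq).one_lt.le)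
  have hpl : 0 ≤ (p : ℝ) / Real.log p := div_nonneg (by linarith) hlp.le
  have hpow : C ^ S.card ≤ C' ^ S.card :=
    (le_abs_self _).trans (by rw [abs_pow]; exact pow_le_pow_left₀ (abs_nonneg C) hCC' _)
  refine h0.trans_le ?_
  have := mul_le_mul_of_nonneg_right (mul_le_mul_of_nonneg_right (mul_le_mul_of_nonneg_right hpow hpl) hL) hP
  exact this

/-! ### The two place bounds from the text -/

/-- **The place bound at `p ∣ a`** from the text at `p` (constant `C ≥ 0`): for an abc triple `(a, b, c)` and a prime
`p ∣ a`, `ν_p(a) log p < theta (max 4 C) b c 0 · ((p/log p)(log p + log max{e, 2 log c}))` — `S` = the primes of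
`bc`, `e_q = ν_q(b) − ν_q(c)`, `∏ q^{e_q} − 1 = b/c − 1 = −a/c`. [cite: StewartYu2001, §3] -/
theorem placeBound_a_of_y07At {C : ℝ} (hC0 : 0 ≤ C) (h : IsABCTriple a b c) {p : ℕ} (hp : p.Prime)
    (hY : Y07At C p) (hpa : p ∣ a) :
    (a.factorization p : ℝ) * Real.log p < theta (max 4 C) b c 0 *
      ((p / Real.log p) * (Real.log p + Real.log (max (Real.exp 1) (2 * Real.log c)))) := by
  classical
  obtain ⟨ha, hb, habc, hcop⟩ := id h
  have hc2 : 2 ≤ c := h.two_le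
  have hc : 0 < c := by omega
  have hbc : b.Coprime c := coprime_right_of_isABCTriple h
  have hac : a.Coprime c := coprime_left_of_isABCTriple h
  set S := (b * c).primeFactors with hSdef
  set Y := Real.log (max (Real.exp 1) (2 * Real.log c)) with hYdef
  have hY1 : 1 ≤ Y := one_le_log_max_exp _
  have hS : ∀ q ∈ S, q.Prime := fun q hq => Nat.prime_of_mem_primeFactors hq
  have hbc0 : b * c ≠ 0 := by positivity
  have hpS : p ∉ S := by
    intro hpS'
    have hpbc : p ∣ b * c := Nat.dvd_of_mem_primeFactors hpS'
    rcases (Nat.Prime.dvd_mul hp).mp hpbc with hpb | hpc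
    · exact hp.one_lt.ne' (Nat.dvd_one.mp (hcop.gcd_eq_one ▸ Nat.dvd_gcd hpa hpb))
    · exact hp.one_lt.ne' (Nat.dvd_one.mp (hac.gcd_eq_one ▸ Nat.dvd_gcd hpa hpc))
  have hSne : S.Nonempty := by
    rw [hSdef, Nat.nonempty_primeFactors]; nlinarith
  -- exponents and their bound
  set e : ℕ → ℤ := fun q => expDiff b c q with hedef
  set B : ℝ := max 3 (3 * Real.log c) with hBdef
  have hB3 : (3 : ℝ) ≤ B := le_max_left _ _
  have hlogc : 0 ≤ Real.log c := Real.log_nonneg (by exact_mod_cast hc)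
  have heB : ∀ q ∈ S, (|e q| : ℝ) ≤ B := by
    intro q hq
    have hq := hS q hq
    have h1 : (|e q| : ℝ) ≤ (b.factorization q : ℝ) + (c.factorization q : ℝ) := by
      simp only [hedef, expDiff]
      push_cast
      refine (abs_sub (b.factorization q : ℝ) (c.factorization q : ℝ)).trans (le_of_eq ?_)
      rw [abs_of_nonneg (by positivity), abs_of_nonneg (by positivity)]
    have h2 := factorization_le_log_c (c := c) hb.ne' hq (by omega)
    have h3 := factorization_le_log_c (c := c) hc.ne' hq le_rfl
    exact h1.trans ((add_le_add h2 h3).trans (by rw [hBdef]; linarith [le_max_right (3 : ℝ) (3 * Real.log c)]))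
  -- the product is `b/c`
  have hprod : ∏ q ∈ S, (q : ℚ) ^ e q = (b : ℚ) / c := (cast_div_eq_prod_zpow hb.ne' hc.ne' hbc).symm
  have hc' : (c : ℚ) ≠ 0 := by exact_mod_cast hc.ne'
  have hne1 : ∏ q ∈ S, (q : ℚ) ^ e q ≠ 1 := by
    rw [hprod, Ne, div_eq_one_iff_eq hc']; exact_mod_cast (show b ≠ c by omega)
  -- the text
  have key := hY S hS hpS hSne e B hB3 heB hne1
  -- `ord_p(b/c − 1) = ν_p(a)`
  have hsub : ∏ q ∈ S, (q : ℚ) ^ e q - 1 = -((a : ℚ) / c) := by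
    rw [hprod]
    field_simp
    exact_mod_cast (show (b : ℤ) - c = -a by omega)
  have hpc : ¬p ∣ c := fun hpc =>
    hp.one_lt.ne' (Nat.dvd_one.mp (hac.gcd_eq_one ▸ Nat.dvd_gcd hpa hpc))
  have hval : padicValRat p (∏ q ∈ S, (q : ℚ) ^ e q - 1) = a.factorization p := by
    haveI : Fact p.Prime := ⟨hp⟩
    rw [hsub, padicValRat.neg, padicValRat.div (by exact_mod_cast ha.ne') hc', padicValRat.of_nat,
      padicValRat.of_nat, padicValNat.eq_zero_of_not_dvd hpc, Nat.factorization_def a hp]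
    simp
  rw [hval, Int.cast_natCast] at key
  -- compare the right-hand sides
  have hp1 : (1 : ℝ) < p := by exact_mod_cast hp.one_lt
  have hlp : 0 < Real.log p := Real.log_pos hp1
  have hl2 : Real.log 2 ≤ Real.log p := Real.log_le_log two_pos (by exact_mod_cast hp.two_le)
  have hlog2 := Real.log_two_gt_d9
  have hpl : 0 ≤ (p : ℝ) / Real.log p := div_nonneg (by linarith) hlp.le
  have hP : 0 ≤ ∏ q ∈ S, Real.log (q : ℝ) :=
    Finset.prod_nonneg fun q hq => Real.log_nonneg (by exact_mod_cast (hS q hq).one_lt.le)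
  -- `log B ≤ log (3/2) + Y ≤ 1/2 + Y`
  have hlogB : Real.log B ≤ 1 / 2 + Y := by
    have hM : B ≤ (3 / 2) * max (Real.exp 1) (2 * Real.log c) := by
      rw [hBdef]; refine max_le ?_ ?_
      · have := Real.exp_one_gt_d9
        have : (3 : ℝ) ≤ 3 / 2 * Real.exp 1 := by linarith
        exact this.trans (by gcongr; exact le_max_left _ _)
      · calc 3 * Real.log c = 3 / 2 * (2 * Real.log c) := by ring
          _ ≤ 3 / 2 * max (Real.exp 1) (2 * Real.log c) := by gcongr; exact le_max_right _ _
    have hM0 : 0 < max (Real.exp 1) (2 * Real.log c) := lt_of_lt_of_le (Real.exp_pos 1) (le_max_left _ _)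
    have h32 : Real.log (3 / 2 : ℝ) ≤ 1 / 2 := by
      have := Real.log_le_sub_one_of_pos (show (0 : ℝ) < 3 / 2 by norm_num); linarith
    calc Real.log B ≤ Real.log ((3 / 2) * max (Real.exp 1) (2 * Real.log c)) :=
          Real.log_le_log (by linarith) hM
      _ = Real.log (3 / 2) + Y := by rw [Real.log_mul (by norm_num) hM0.ne']
      _ ≤ 1 / 2 + Y := by linarith
  -- `log log A ≤ log 2 + Y`
  have hllA : Real.log (Real.log ((max 4 (S.sup id) : ℕ) : ℝ)) ≤ Real.log 2 + Y := by
    refine loglog_le_of_le_four_mul_sq (c := c) (by exact_mod_cast le_max_left _ _) hc2 ?_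
    exact cast_max_four_sup_le (by nlinarith) hc2
  have hlog2' := Real.log_two_lt_d9
  have hsum : Real.log p + Real.log B + Real.log (Real.log ((max 4 (S.sup id) : ℕ) : ℝ)) ≤
      4 * (Real.log p + Y) := by linarith
  -- `C^n · 4 ≤ K^{n+1}`
  set K : ℝ := max 4 C with hKdef
  have hK4 : (4 : ℝ) ≤ K := le_max_left _ _
  have hCK : C ≤ K := le_max_right _ _
  have hpowK : C ^ S.card * 4 ≤ K ^ (S.card + 1) := by
    rw [pow_succ]
    exact mul_le_mul (pow_le_pow_left₀ hC0 hCK _) hK4 (by norm_num) (by positivity)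
  have hθ : theta K b c 0 = K ^ (S.card + 1) * ∏ q ∈ S, Real.log (q : ℝ) := by
    rw [theta_zero_eq K hb.ne' hc.ne' hbc]
  rw [hθ]
  set PL := ∏ q ∈ S, Real.log (q : ℝ) with hPL
  have hLY : 0 ≤ Real.log p + Y := by linarith
  calc (a.factorization p : ℝ) * Real.log p
      < C ^ S.card * ((p : ℝ) / Real.log p) *
          (Real.log p + Real.log B + Real.log (Real.log ((max 4 (S.sup id) : ℕ) : ℝ))) * PL := key
    _ ≤ C ^ S.card * ((p : ℝ) / Real.log p) * (4 * (Real.log p + Y)) * PL := by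
        have h0 : 0 ≤ C ^ S.card * ((p : ℝ) / Real.log p) := mul_nonneg (pow_nonneg hC0 _) hpl
        exact mul_le_mul_of_nonneg_right (mul_le_mul_of_nonneg_left hsum h0) hP
    _ = (C ^ S.card * 4) * (PL * ((p / Real.log p) * (Real.log p + Y))) := by ring
    _ ≤ K ^ (S.card + 1) * (PL * ((p / Real.log p) * (Real.log p + Y))) := by
        have h0 : 0 ≤ PL * ((p / Real.log p) * (Real.log p + Y)) := by positivity
        exact mul_le_mul_of_nonneg_right hpowK h0
    _ = K ^ (S.card + 1) * PL * ((p / Real.log p) * (Real.log p + Y)) := by ring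


end PrimesDoor

end Summit.ABC.StewartYu.KummerThird

end
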